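import Summits.QuantumFields.YangMills.Theorems.BalabanUVNodesN08AtRecord13
import Literature.MathematicalPhysics.QuantumFieldTheory.Balaban1983to89.Node00.Record13CarriersCoP
import Literature.MathematicalPhysics.QuantumFieldTheory.Balaban1983to89.Node00.Record13LiveSelectorFamily

/-!
# v1.5 `CoP` EDITION — director-ym LINE №160 ∕ №162 ((y) FINAL, EDITION FREEZE): RECORD 13 re-seeded at print's COLLAR-ranged background class (node00-def-R FILE 22′
# `LargeFieldBackgroundCoPOfRecord`, `UbgMSCoPOfRecord`) and the collar-exempt 𝐓-weights (def-T 12a″); def-T FILE 23 `Node00/Record13CoP` (p520810) + 24T `Node00/Record13SepCoP`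
# (p521293), token tables KEY-23 ∕ KEY-24T = «the v1.4 names with `Co ↦ CoP`» (`toStage5₁₃CoP`, `datumOfRecord₁₃CoP`, `IsRecordOfRecord₁₃CCoP`, `Provisos₁₃SepCoP`, `datumOfRecord₁₃SepCoP`,
# `IsRecordOfRecord₁₃CSepCoP(.toCoP)`; `Provisos₁₃Core` token-identical), dag-n10-d's CoP carrier leaves `Node00/Record13CarriersCoP ∕ Record13CarriersSepCoP` (`toStage5₁₃CoP_pin<G> ∕ _rebindX`,
# `view₁₃CoPB10YZW(_eq)`, `datumOfRecord₁₃(Sep)CoP_pin<G>`, `isRecordOfRecord₁₃C(Sep)CoP_pinB10_of_eq ∕ _rebindX_of_eq`, `exists_world_isRecordOfRecord₁₃CCoP_rebindX`).  THIS FILE is the verbatim token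
# image (of this seat's v1.4 Co storey `BalabanUVNodesN08AtRecord13Co` (p517790)) under that table (generator `tools/cop_n08_gen.py`); statement SHAPES and proofs identical up to the tokens; the source module stays as the v1.4 sibling.
#
# BalabanUVNodes ∕ N08 AT THE STAGE-13 RECORD AT PRINT'S BACKGROUND — the CoP ∕ Core re-key (KEY-RULE-21) of N08's ₁₃ storey `BalabanUVNodesN08AtRecord13` (p491313) at
# def-T's FILE 23 `Node00/Record13CoP` (p520810: the Stage-5 view `Stage13Params.toStage5₁₃CoP`, the Core-keyed datum `datumOfRecord₁₃CoP (h : Provisos₁₃Core)` and record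
# `IsRecordOfRecord₁₃CCoP`, director-ym LINE №152 RULING (β): RECORD 13 re-based ONCE at print's background `UbgOfRecord₁₃CoP`, level `n+1` = def-R's minimiser `UbgMSCoOfRecord`
# over [6]'s class (1.7) ∧ (1.9)) and dag-n10-d's CoP carrier stack `Node00/Record13CarriersCoP` (the CoP image of FILE 4 p516386: `Stage13Params.toStage5₁₃CoP_pinB10`, the four-pin view
# `Stage13Params.view₁₃CoPB10YZW` + `_eq` + `upOfRecord₅C_view₁₃CoPB10YZW_leaves`, `datumOfRecord₁₃CoP_pin<G>`, `isRecordOfRecord₁₃CCoP_pinB10_of_eq`)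
# (Track A, DAG node N08 [Balaban1985UV3] CMP **102** (1985) 255, Thm 1 p. 257 (compact reading) + Thm 2 p. 272; R134 fan-out seat `pub-ymgap-dag-n08-c` g15, strategy s2
# «knit at the record of record», trigger (t19‴) = def-T KEY-21C → KEY-23; dag-lead ORPHAN-STOREYS row A1, 2026-08-27)

WHY THIS FILE.  Under RULING (β) every view-bound world clause of RECORD 13 moves with the background: `IsRecordOfRecord₁₃CCoP … w`'s last conjunct reads
`w.up P = upOfRecord₅C F N (θ.toStage5₁₃CoP F N) P`, and `toStage5₁₃CoP`'s residual pins `VOfRecord₁₃CoP` ∕ `S218OfRecord₁₃CoP` (print's background) where p491313's `toStage5₁₃`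
pinned the U_old ones.  So p491313 — keyed on the v1.1 provisos `Provisos₁₃`, the U_old datum `datumOfRecord₁₃`, record `IsRecordOfRecord₁₃C` and view `toStage5₁₃ ∕ view₁₃B10YZW`
— is NOT instantiable at a CoP record, and its §1 pointed closers read the wrong Stage-5 view.  This module is its IMAGE under def-T's KEY-RULE-21 ∕ KEY-21C ∕ KEY-23 token map
`IsRecordOfRecord₁₃C ↦ IsRecordOfRecord₁₃CCoP`, `(h : θ.Provisos₁₃) ↦ (h : θ.Provisos₁₃Core)` (R4: the background-FREE proviso core is the key of every `h`-keyed Co face; holders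
of the v1.5 provisos `Provisos₁₃SepCoP` pass `h.toCore`), `datumOfRecord₁₃ ↦ datumOfRecord₁₃CoP`, `toStage5₁₃ ↦ toStage5₁₃CoP`, `view₁₃B10YZW ↦ view₁₃CoPB10YZW`,
`atWorld_of_ ∕ construction_eq_of_isRecordOfRecord₁₃C ↦ …₁₃CCoP` — statement SHAPES verbatim, proofs re-checked; the §1 closers are again ONE `exact` each over this seat's
record-stage-generic `BalabanUVNodesN08AtStage5View` (p489533; generic over ANY [B10]-pinned `Stage5Params` view — that module needs NO CoP twin).  The θ-level faces of
p491313 §0b that read no background — the guard-per-pin `N08AtRecord13.guard_pinB10 ∕ pinY ∕ pinZ ∕ pinW_iff` (`Iff.rfl`) and `theta13LiveOfRecord_L ∕ _γ` (`rfl`) — are CITED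
from p491313, not re-declared (dag-lead DEDUP-113: one public name per object).  NOT imaged: p491313's `…_of_bg_two` (its hypothesis is K0a's U_old row-P11 socket text at
`UbgOfRecord₁₃`; the CoP socket is node00-def-K0a's 15a∕15b, not this seat's).

WHAT IS PROVED (all bookkeeping BY NAME, one `exact`∕`obtain` each):
* §0 the in-edge guards `b4 b5 b6 b7` at every run of every ₁₃CCoP record (def-T's `atWorld_of_isRecordOfRecord₁₃CCoP`), hence N08 there reads `b8 → b9 → b11 → b10`;
* §0b the [B10]-pinned CoP view's `b10` leaf `= PrintedUV3V N θ.L` (n10-d's `toStage5₁₃CoP_pinB10`, `rfl`), the four-pin CoP view IS p489533's four-pin word at `σ := θ.toStage5₁₃CoP`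
  (`rfl`), and «a world with def-T's pointed clauses bound over the [B10]-pinned ∕ the four-pin CoP view IS a ₁₃CCoP record AT `datumOfRecord₁₃CoP θ h`» + its existence, any
  window `0 < γw ≤ θ.γ` (n10-d's `Provisos₁₃Core.pin<G>`, `datumOfRecord₁₃CoP_pin<G>`, `isRecordOfRecord₁₃CCoP_pinB10_of_eq`, `view₁₃CoPB10YZW_eq`);
* §1 POINTED CLOSERS at a world bound over `(θ.pinB10).toStage5₁₃CoP`, over any four-pin word over `θ.toStage5₁₃CoP`, over n10-d's `θ.view₁₃CoPB10YZW` and the [B8]-inner S-bound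
  five-pin words: N08 ⟸ `PrintedUV3V N θ.L` (and ⟺ «in-edges → it»; converse `printedUV3V_of_…`) — proviso-free, edition-free: the binders every later proviso edition
  (v1.5 `…SepCoP`) presents its record's world in;
* §2 THE ∃-CURRENCY AT THE CORE KEY: from `θ`, `h : θ.Provisos₁₃Core F N`, admissibility and `PrintedUV3V N θ.L` — a world that IS a ₁₃CCoP record of `datumOfRecord₁₃CoP θ h`,
  bound over the pinned ∕ four-pin CoP view, carrying N08 at every run; the PINNED and FOUR-PIN PRESENTATIONS (same datum, guard `ZtUnity ∧ SlotsNondegenerate₁₃` and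
  admissibility read AT the presenting parameter); «`∃ θ, Provisos₁₃Core ∧ (ZtUnity ∧ SlotsNondegenerate₁₃) ∧ Admissible` + the slot at every odd `L > 1` ⟹ N08's conjunct
  of a Core-keyed nodes-∃» (`…_of_inhabited13Core`, `_two` at `N = 2`);
* §3 on the WITNESS LINE OF RECORD `θ₁₃ = theta13LiveOfRecord F N` (node00-def-K0a; a θ-level maker — background-free; `L = F.L`, `γ = 1∕2`): N08's share costs
  `hP : θ₁₃.Provisos₁₃Core F N` (HYPOTHESIS, opaque) + `PrintedUV3V N F.L`; the guard is K0a's HYPOTHESIS-FREE `ztUnity_theta13LiveOfRecord` ∕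
  `slotsNondegenerate₁₃_theta13LiveOfRecord_of_hasResiduals`, admissibility its `admissible_theta13LiveOfRecord`, BY NAME.

HONEST FRAMING.  Count-neutral kernel bookkeeping BY NAME — a re-keying of a LANDED storey to the corrected record (new file; p491313 stays as the pre-№152 sibling).  NOT A
DISCHARGE OF N08: `PrintedUV3V` is TYPED and DISPLAYED as a hypothesis (resp. returned as the pin), NOT PROVED — an inhabitant (the [B10] cluster expansion at print's run
objects) remains THE object gap; `Provisos₁₃Core`, admissibility and the guard are hypotheses or K0a's theorems, never asserted; K0 ∕ K1 neither proved nor assumed; nothing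
of Bałaban's asserted; one finite four-torus per run at fixed `ε`, [B10]'s d = 3 lattices inside the record; nothing continuum ∕ ℝ⁴ ∕ OS ∕ mass gap ∕ Clay.  0 `sorry`,
0 `def`, standard axioms.  Sources: [Balaban1985UV3] Thm 1 p.257, Thm 2 p.272; [Balaban1989LargeFieldII] Thm 1 + (0.1) pp.355–356; [Balaban1988Convergent] (2.18) p.257,
(2.28) p.259, (3.16)–(3.22) pp.268–269; [Balaban1985Variational] (5)–(7) p.278 (print's background); [Balaban1985RegularSpaces] (1.7), (1.9) p.77; [Balaban1987RG1] (0.21) p.256.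
-/

noncomputable section

namespace Summit.QuantumFields.YangMills.BalabanUVNodes.N08AtRecord13CoP

open Literature.MathematicalPhysics.QuantumFieldTheory.Balaban1983to89
open Literature.MathematicalPhysics.QuantumFieldTheory.Balaban1983to89.T4Continuum (T4Family FiniteEpsData)
open Literature.MathematicalPhysics.QuantumFieldTheory.Balaban1983to89.DagBinding
  (WorldP leavesP PrintedCarriersR PrintedCarriers9X PrintedCarriers11 PrintedCarriers15)
open Literature.MathematicalPhysics.QuantumFieldTheory.Balaban1983to89.Node00
open Summit.QuantumFields.YangMills.BalabanUVNodes.N08AtStage5View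
open scoped Matrix.Norms.L2Operator

variable {F : T4Family} {N : ℕ} [NeZero N]

/-! ## §0 THE IN-EDGE GUARDS AT EVERY RUN OF EVERY STAGE-13 RECORD AT PRINT'S BACKGROUND (Core key) -/

section Guards
variable {D : FiniteEpsData F (SU N)} {w : WorldP}

/-- **In-edge guards at every run of a ₁₃CCoP record**: the leaves `b4`, `b5`, `b6`, `b7` HOLD — N01 ∕ N02 ∕ N03 ∕ N04 are NODE 00 theorems at the Stage-5 shadow
(`Node00.b4∕b5∕b7_main_of_isRecordOfRecord₅C`, `Node00.N03_at_record₅C`), transferred by def-T's FILE 23 `Node00.atWorld_of_isRecordOfRecord₁₃CCoP` (p491313 §0, re-keyed; holders of a v1.5 record pass `.toCoP`).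
[cite: Balaban1983RegularityDecay, Theorem p.573; Balaban1984PropagatorsI, Props. 1.1–1.2 pp.33–36; Balaban1984PropagatorsII, Lemma 2.1 – Cor. 2.8 pp.234–249; Balaban1985Averaging, Props. 1–10 pp.26–50 (kernel versions at the objects of record; bookkeeping, transferred)] -/
theorem guards_of_isRecordOfRecord₁₃CCoP (h : IsRecordOfRecord₁₃CCoP F N D w) (P : B12.RunParams) :
    (leavesP w P).b4 ∧ (leavesP w P).b5 ∧ (leavesP w P).b6 ∧ (leavesP w P).b7 :=
  atWorld_of_isRecordOfRecord₁₃CCoP (X := fun ℓ => ℓ.b4 ∧ ℓ.b5 ∧ ℓ.b6 ∧ ℓ.b7)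
    (fun _ _ h5 Q =>
      have h4 := b4_main_of_isRecordOfRecord₅C h5 Q
      have hb5 := b5_main_of_isRecordOfRecord₅C h5 Q h4
      ⟨h4, hb5, N03_at_record₅C h5 Q h4 hb5, b7_main_of_isRecordOfRecord₅C h5 Q hb5⟩)
    h P

/-- Hence at a ₁₃CCoP record N08 reads `b8 → b9 → b11 → b10` (the in-edges `b5 b6 b7` drop out). [cite: Balaban1985UV3, Thm 1 p.257, Thm 2 p.272 (bookkeeping)] -/
theorem b10_main_iff_residual_of_isRecordOfRecord₁₃CCoP (h : IsRecordOfRecord₁₃CCoP F N D w) (P : B12.RunParams) :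
    Dag.B10_main (leavesP w P) ↔ ((leavesP w P).b8 → (leavesP w P).b9 → (leavesP w P).b11 → (leavesP w P).b10) := by
  obtain ⟨-, h5, h6, h7⟩ := guards_of_isRecordOfRecord₁₃CCoP h P
  exact ⟨fun H h8 h9 h11 => H h5 h6 h7 h8 h9 h11, fun H _ _ _ h8 h9 h11 => H h8 h9 h11⟩

end Guards

/-! ## §0b THE [B10]-PIN ∕ FOUR-PIN CoP-VIEW FACES THIS FILE READS, over dag-n10-d's `Node00/Record13CarriersCoP` (`Stage13Params.toStage5₁₃CoP_pinB10`, `view₁₃CoPB10YZW(_eq)`,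
`datumOfRecord₁₃CoP_pin<G>`, `isRecordOfRecord₁₃CCoP_pinB10_of_eq`, `upOfRecord₅C(S)_view₁₃CoP…_leaves`), `Record13CarriersSep` §1 (`Provisos₁₃Core.pin<G>`) and `Record13Carriers`
(`Stage13Params.pin<G>`, `…_admissible_iff`) BY NAME: the pinned CoP view's `b10` leaf, the ₁₃CCoP record over the FOUR-PIN CoP view, and the two world constructions — in THIS
namespace; the guard-per-pin faces are p491313's `N08AtRecord13.guard_pin<G>_iff` (θ-level, cited) -/

section PinFaces
variable (θ : Stage13Params F N)

/-- **`(upOfRecord₅C ((θ.pinB10).toStage5₁₃CoP) P).b10 ↔ PrintedUV3V N θ.L`** — g29's Stage-5 face along `Record13CarriersCoP`'s `toStage5₁₃CoP_pinB10` (`rfl`). [cite: Balaban1985UV3, Thm 1 p.257 (compact reading) + Thm 2 p.272] -/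
theorem upOfRecord₅C_toStage5₁₃CoP_pinB10_b10_iff (P : B12.RunParams) :
    (upOfRecord₅C F N ((θ.pinB10 F N).toStage5₁₃CoP F N) P).b10 ↔ PrintedUV3V N θ.L := by
  rw [Stage13Params.toStage5₁₃CoP_pinB10]
  exact upOfRecord₅C_pinB10_b10_iff F N (θ.toStage5₁₃CoP F N) P

/-- … read by n05-a's S-binding (which re-binds `b8` only; `Iff.rfl` through it). [cite: Balaban1985UV3, Thm 1 p.257 + Thm 2 p.272; Balaban1985RegularSpaces, Thm 8 p.101 (bookkeeping)] -/
theorem upOfRecord₅CS_toStage5₁₃CoP_pinB10_b10_iff (P : B12.RunParams) :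
    (upOfRecord₅CS F N ((θ.pinB10 F N).toStage5₁₃CoP F N) P).b10 ↔ PrintedUV3V N θ.L :=
  upOfRecord₅C_toStage5₁₃CoP_pinB10_b10_iff θ P

/-- n10-d's `Stage13Params.view₁₃CoPB10YZW` IS p489533's four-pin word at `σ := θ.toStage5₁₃CoP` (`rfl`). [cite: Balaban1989LargeFieldII, Thm 1 p.355 (bookkeeping)] -/
theorem view₁₃CoPB10YZW_eq_pin4 (Mstar : ℕ) (ops : OpsY N θ.toStage3Params Mstar) (ζ : ResidZ F N) (lamW : ResidW F N) :
    θ.view₁₃CoPB10YZW F N Mstar ops ζ lamW =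
      ((((θ.toStage5₁₃CoP F N).pinB10 F N).pinY F N (Y9OfRecord N θ.toStage3Params Mstar ops)).pinZ F N (Z11OfRecord F N ζ)).pinW F N (WOfRecord₁₃ F N θ lamW) :=
  rfl

/-- **EVERY admissible Stage-13 parameter with the CORE provisos presents a ₁₃CCoP record at its own CoP datum whose world is bound over the [B10]-PINNED CoP view**, any window
`0 < γw ≤ θ.γ`, block size `θ.L` (def-T's world construction at `θ.pinB10`, through `Record13CarriersCoP`'s `isRecordOfRecord₁₃CCoP_pinB10_of_eq`). [cite: Balaban1989LargeFieldII, Thm 1 + (0.1) pp.355–356 (bookkeeping)] -/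
theorem exists_world_isRecordOfRecord₁₃CCoP_pinB10 (h : θ.Provisos₁₃Core F N) (hθ : θ.Admissible F N) {γw : ℝ} (hγw : 0 < γw ∧ γw ≤ θ.γ) :
    ∃ w : WorldP, IsRecordOfRecord₁₃CCoP F N (datumOfRecord₁₃CoP F N θ h) w ∧ w.γ = γw ∧ w.L = (θ.L : ℝ) ∧
      ∀ P, w.up P = upOfRecord₅C F N ((θ.pinB10 F N).toStage5₁₃CoP F N) P := by
  obtain ⟨w₀⟩ := nonempty_worldP
  exact ⟨{ w₀ with
      C := (datumOfRecord₁₃CoP F N θ h).C, γ := γw, L := (θ.L : ℝ), one_lt_L := by exact_mod_cast θ.hL.2,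
      up := fun P => upOfRecord₅C F N ((θ.pinB10 F N).toStage5₁₃CoP F N) P },
    isRecordOfRecord₁₃CCoP_pinB10_of_eq F N θ h hθ _ rfl hγw rfl (fun _ => rfl), rfl, rfl, fun _ => rfl⟩

/-- **A world with def-T's pointed clauses bound over n10-d's FOUR-PIN CoP view IS a ₁₃CCoP record AT `datumOfRecord₁₃CoP θ h`** (presenting parameter the quadruply pinned
`θ`; Core provisos transported pin by pin, datum by the four `rfl`s, view by `view₁₃CoPB10YZW_eq` — p491313 §0b re-keyed).
[cite: Balaban1989LargeFieldII, Thm 1 + (0.1) pp.355–356 (bookkeeping)] -/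
theorem isRecordOfRecord₁₃CCoP_view₁₃CoPB10YZW_of_eq (h : θ.Provisos₁₃Core F N) (hθ : θ.Admissible F N) (Mstar : ℕ) (ops : OpsY N θ.toStage3Params Mstar)
    (ζ : ResidZ F N) (lamW : ResidW F N) (w : WorldP) (hC : w.C = (datumOfRecord₁₃CoP F N θ h).C) (hγ : 0 < w.γ ∧ w.γ ≤ θ.γ) (hL : w.L = (θ.L : ℝ))
    (hup : ∀ P, w.up P = upOfRecord₅C F N (θ.view₁₃CoPB10YZW F N Mstar ops ζ lamW) P) :
    IsRecordOfRecord₁₃CCoP F N (datumOfRecord₁₃CoP F N θ h) w := by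
  have h₁ : (θ.pinB10 F N).Provisos₁₃Core F N := h.pinB10
  have h₂ : ((θ.pinB10 F N).pinY F N (Y9OfRecord N θ.toStage3Params Mstar ops)).Provisos₁₃Core F N := h₁.pinY _
  have h₃ : (((θ.pinB10 F N).pinY F N (Y9OfRecord N θ.toStage3Params Mstar ops)).pinZ F N (Z11OfRecord F N ζ)).Provisos₁₃Core F N := h₂.pinZ _
  have h₄ : ((((θ.pinB10 F N).pinY F N (Y9OfRecord N θ.toStage3Params Mstar ops)).pinZ F N (Z11OfRecord F N ζ)).pinW F N (WOfRecord₁₃ F N θ lamW)).Provisos₁₃Core F N :=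
    h₃.pinW _
  have hθ' : ((((θ.pinB10 F N).pinY F N (Y9OfRecord N θ.toStage3Params Mstar ops)).pinZ F N (Z11OfRecord F N ζ)).pinW F N (WOfRecord₁₃ F N θ lamW)).Admissible F N :=
    (Stage13Params.pinW_admissible_iff F N _ _).2 ((Stage13Params.pinZ_admissible_iff F N _ _).2
      ((Stage13Params.pinY_admissible_iff F N _ _).2 ((Stage13Params.pinB10_admissible_iff F N _).2 hθ)))
  refine ⟨_, h₄, hθ', ?_, hC, hγ, hL, fun P => ?_⟩
  · rw [datumOfRecord₁₃CoP_pinW F N _ h₃, datumOfRecord₁₃CoP_pinZ F N _ h₂, datumOfRecord₁₃CoP_pinY F N _ h₁, datumOfRecord₁₃CoP_pinB10 F N θ h]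
  · rw [hup P, Stage13Params.view₁₃CoPB10YZW_eq]

/-- … hence EVERY admissible Stage-13 parameter with the Core provisos presents a ₁₃CCoP record at its own CoP datum whose world is bound over the FOUR-PIN CoP view (package EXPOSED: any floor
`Mstar`, operator layer `ops`, [B11] layer `ζ`, [IV] layer `lamW`), any window, block size `θ.L`. [cite: Balaban1989LargeFieldII, Thm 1 + (0.1) pp.355–356 (bookkeeping)] -/
theorem exists_world_isRecordOfRecord₁₃CCoP_view₁₃CoPB10YZW (h : θ.Provisos₁₃Core F N) (hθ : θ.Admissible F N) (Mstar : ℕ) (ops : OpsY N θ.toStage3Params Mstar)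
    (ζ : ResidZ F N) (lamW : ResidW F N) {γw : ℝ} (hγw : 0 < γw ∧ γw ≤ θ.γ) :
    ∃ w : WorldP, IsRecordOfRecord₁₃CCoP F N (datumOfRecord₁₃CoP F N θ h) w ∧ w.γ = γw ∧ w.L = (θ.L : ℝ) ∧
      ∀ P, w.up P = upOfRecord₅C F N (θ.view₁₃CoPB10YZW F N Mstar ops ζ lamW) P := by
  obtain ⟨w₀⟩ := nonempty_worldP
  exact ⟨{ w₀ with
      C := (datumOfRecord₁₃CoP F N θ h).C, γ := γw, L := (θ.L : ℝ), one_lt_L := by exact_mod_cast θ.hL.2,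
      up := fun P => upOfRecord₅C F N (θ.view₁₃CoPB10YZW F N Mstar ops ζ lamW) P },
    isRecordOfRecord₁₃CCoP_view₁₃CoPB10YZW_of_eq θ h hθ Mstar ops ζ lamW _ rfl hγw rfl (fun _ => rfl), rfl, rfl, fun _ => rfl⟩

end PinFaces

/-! ## §1 POINTED CLOSERS AT A WORLD BOUND OVER THE [B10]-PINNED STAGE-13 CoP VIEW `toStage5₁₃CoP` — proviso-free, edition-free; cost: the one slot instance `PrintedUV3V N θ.L` -/

section Pointed
variable (θ : Stage13Params F N) {w : WorldP}

/-- **EXACT READING**: at a world whose upstream block is the C-binding over `(θ.pinB10).toStage5₁₃CoP`, the run's `b10` leaf IS `PrintedUV3V N θ.L` (§0b's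
`upOfRecord₅C_toStage5₁₃CoP_pinB10_b10_iff` read through p489533's generic atom). [cite: Balaban1985UV3, Thm 1 p.257 (compact reading) + Thm 2 p.272] -/
theorem b10_leaf_iff_of_up_pinB10 (hup : ∀ P, w.up P = upOfRecord₅C F N ((θ.pinB10 F N).toStage5₁₃CoP F N) P) (P : B12.RunParams) :
    (leavesP w P).b10 ↔ PrintedUV3V N θ.L :=
  b10_leaf_iff_of_up_eq (hup P) (upOfRecord₅C_toStage5₁₃CoP_pinB10_b10_iff θ P)

/-- **EXACT COST** there: N08 ⟺ «in-edge leaves `b5 b6 b7 b8 b9 b11` ⟹ `PrintedUV3V N θ.L`». [cite: Balaban1985UV3, Thm 1 p.257, Thm 2 p.272 (bookkeeping)] -/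
theorem b10_main_iff_of_up_pinB10 (hup : ∀ P, w.up P = upOfRecord₅C F N ((θ.pinB10 F N).toStage5₁₃CoP F N) P) (P : B12.RunParams) :
    Dag.B10_main (leavesP w P) ↔
      ((leavesP w P).b5 → (leavesP w P).b6 → (leavesP w P).b7 → (leavesP w P).b8 → (leavesP w P).b9 → (leavesP w P).b11 → PrintedUV3V N θ.L) :=
  b10_main_iff_of_up_eq (hup P) (upOfRecord₅C_toStage5₁₃CoP_pinB10_b10_iff θ P)

/-- **N08 AT SUCH A WORLD FROM `PrintedUV3V N θ.L`** (in-edges unused; no datum, window or residual-layer hypothesis) — the PINNED binder a pointed Stage-13 assembler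
(dag-n24-c's `N24_nodes₁₃_pointed` shape, presented at `θ.pinB10`) takes for N08 in place of the raw leaf-system slot. [cite: Balaban1985UV3, Thm 1 p.257 (compact reading) + Thm 2 p.272; Balaban1989LargeFieldII, Thm 1 + (0.1) pp.355–356 (bookkeeping)] -/
theorem b10_main_of_up_pinB10 (hup : ∀ P, w.up P = upOfRecord₅C F N ((θ.pinB10 F N).toStage5₁₃CoP F N) P) (hUV : PrintedUV3V N θ.L) (P : B12.RunParams) :
    Dag.B10_main (leavesP w P) :=
  b10_main_of_up_eq (hup P) (upOfRecord₅C_toStage5₁₃CoP_pinB10_b10_iff θ P) hUV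

/-- Conversely N08 is not idle there: with its in-edge leaves it GIVES `PrintedUV3V N θ.L`. [cite: Balaban1985UV3, Thm 1 p.257, Thm 2 p.272 (bookkeeping)] -/
theorem printedUV3V_of_b10_main_of_up_pinB10 (hup : ∀ P, w.up P = upOfRecord₅C F N ((θ.pinB10 F N).toStage5₁₃CoP F N) P) {P : B12.RunParams}
    (h : Dag.B10_main (leavesP w P)) (h5 : (leavesP w P).b5) (h6 : (leavesP w P).b6) (h7 : (leavesP w P).b7) (h8 : (leavesP w P).b8)
    (h9 : (leavesP w P).b9) (h11 : (leavesP w P).b11) : PrintedUV3V N θ.L :=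
  of_b10_main_of_up_eq (hup P) (upOfRecord₅C_toStage5₁₃CoP_pinB10_b10_iff θ P) h h5 h6 h7 h8 h9 h11

/-- The same world spelled over `(θ.toStage5₁₃CoP).pinB10` (def-T's view, g29's Stage-5 pin; `toStage5₁₃CoP_pinB10 : rfl`). [cite: Balaban1985UV3, Thm 1 p.257 + Thm 2 p.272 (bookkeeping)] -/
theorem b10_main_of_up_toStage5₁₃CoP_pinB10 (hup : ∀ P, w.up P = upOfRecord₅C F N ((θ.toStage5₁₃CoP F N).pinB10 F N) P) (hUV : PrintedUV3V N θ.L)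
    (P : B12.RunParams) : Dag.B10_main (leavesP w P) :=
  N08AtStage5View.b10_main_of_up_pinB10 (θ.toStage5₁₃CoP F N) (hup P) hUV

/-- S-binding twin (a world bound by n05-a's S-binding over the pinned Stage-13 view). [cite: Balaban1985UV3, Thm 1 p.257 + Thm 2 p.272; Balaban1985RegularSpaces, Thm 8 p.101 (bookkeeping)] -/
theorem b10_main_of_upS_pinB10 (hup : ∀ P, w.up P = upOfRecord₅CS F N ((θ.pinB10 F N).toStage5₁₃CoP F N) P) (hUV : PrintedUV3V N θ.L) (P : B12.RunParams) :
    Dag.B10_main (leavesP w P) :=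
  b10_main_of_up_eq (hup P) (upOfRecord₅CS_toStage5₁₃CoP_pinB10_b10_iff θ P) hUV

/-- **N08 AT A WORLD BOUND OVER ANY FOUR-PIN WORD OVER THE STAGE-13 VIEW** — `(((θ.toStage5₁₃CoP.pinB10).pinY Y₀).pinZ Z₀).pinW W₀` for EVERY `Y₀ Z₀ W₀` (what a cumulative
Stage-13 view `view₁₃CoPB10YZW` unfolds to) — from `PrintedUV3V N θ.L` (p489533 §3 at `σ := θ.toStage5₁₃CoP`). [cite: Balaban1985UV3, Thm 1 p.257 (compact reading) + Thm 2 p.272; Balaban1989LargeFieldII, Thm 1 + (0.1) pp.355–356 (bookkeeping)] -/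
theorem b10_main_of_up_pin4 (Y₀ : PrintedCarriers9X) (Z₀ : PrintedCarriers11) (W₀ : B12.RunParams → PrintedCarriers15)
    (hup : ∀ P, w.up P = upOfRecord₅C F N (((((θ.toStage5₁₃CoP F N).pinB10 F N).pinY F N Y₀).pinZ F N Z₀).pinW F N W₀) P) (hUV : PrintedUV3V N θ.L)
    (P : B12.RunParams) : Dag.B10_main (leavesP w P) :=
  N08AtStage5View.b10_main_of_up_pin4 (θ.toStage5₁₃CoP F N) Y₀ Z₀ W₀ hup hUV P

/-- … exact cost there. [cite: Balaban1985UV3, Thm 1 p.257, Thm 2 p.272 (bookkeeping)] -/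
theorem b10_main_iff_of_up_pin4 (Y₀ : PrintedCarriers9X) (Z₀ : PrintedCarriers11) (W₀ : B12.RunParams → PrintedCarriers15)
    (hup : ∀ P, w.up P = upOfRecord₅C F N (((((θ.toStage5₁₃CoP F N).pinB10 F N).pinY F N Y₀).pinZ F N Z₀).pinW F N W₀) P) (P : B12.RunParams) :
    Dag.B10_main (leavesP w P) ↔
      ((leavesP w P).b5 → (leavesP w P).b6 → (leavesP w P).b7 → (leavesP w P).b8 → (leavesP w P).b9 → (leavesP w P).b11 → PrintedUV3V N θ.L) :=
  N08AtStage5View.b10_main_iff_of_up_pin4 (θ.toStage5₁₃CoP F N) Y₀ Z₀ W₀ hup P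

/-- … and over the [B8]-inner five-pin word bound by the S-binding (the world shape of a `…CB10YZWB8` key at Stage 13). [cite: Balaban1985UV3, Thm 1 p.257 + Thm 2 p.272; Balaban1985RegularSpaces, Thm 8 p.101 (bookkeeping)] -/
theorem b10_main_of_upS_pinB8_pin4 (lam : ResidB8 θ.toStage3Params) (Y₀ : PrintedCarriers9X) (Z₀ : PrintedCarriers11)
    (W₀ : B12.RunParams → PrintedCarriers15)
    (hup : ∀ P, w.up P = upOfRecord₅CS F N ((((((θ.toStage5₁₃CoP F N).pinB8 F N lam).pinB10 F N).pinY F N Y₀).pinZ F N Z₀).pinW F N W₀) P)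
    (hUV : PrintedUV3V N θ.L) (P : B12.RunParams) : Dag.B10_main (leavesP w P) :=
  N08AtStage5View.b10_main_of_upS_pinB8_pin4 (θ.toStage5₁₃CoP F N) lam Y₀ Z₀ W₀ hup hUV P


/-- **N08 AT A WORLD BOUND OVER n10-d's FOUR-PIN STAGE-13 VIEW `θ.view₁₃CoPB10YZW Mstar ops ζ lamW`**, from `PrintedUV3V N θ.L` — ONE `exact` over p489533 (the view IS the
four-pin word, `view₁₃CoPB10YZW_eq_pin4`). [cite: Balaban1985UV3, Thm 1 p.257 (compact reading) + Thm 2 p.272; Balaban1989LargeFieldII, Thm 1 + (0.1) pp.355–356 (bookkeeping)] -/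
theorem b10_main_of_up_view₁₃CoPB10YZW (Mstar : ℕ) (ops : OpsY N θ.toStage3Params Mstar) (ζ : ResidZ F N) (lamW : ResidW F N)
    (hup : ∀ P, w.up P = upOfRecord₅C F N (θ.view₁₃CoPB10YZW F N Mstar ops ζ lamW) P) (hUV : PrintedUV3V N θ.L) (P : B12.RunParams) :
    Dag.B10_main (leavesP w P) :=
  N08AtStage5View.b10_main_of_up_pin4 (θ.toStage5₁₃CoP F N) _ _ _ hup hUV P

/-- … exact reading there (= the `b10` conjunct of n10-d's `upOfRecord₅C_view₁₃CoPB10YZW_leaves`, read at the world). [cite: Balaban1985UV3, Thm 1 p.257 + Thm 2 p.272 (bookkeeping)] -/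
theorem b10_leaf_iff_of_up_view₁₃CoPB10YZW (Mstar : ℕ) (ops : OpsY N θ.toStage3Params Mstar) (ζ : ResidZ F N) (lamW : ResidW F N)
    (hup : ∀ P, w.up P = upOfRecord₅C F N (θ.view₁₃CoPB10YZW F N Mstar ops ζ lamW) P) (P : B12.RunParams) : (leavesP w P).b10 ↔ PrintedUV3V N θ.L :=
  b10_leaf_iff_of_up_eq (hup P) (upOfRecord₅C_view₁₃CoPB10YZW_leaves F N θ Mstar ops ζ lamW P).2.2.1

/-- … and over the five-pin view with [B8] bound by the S-binding (`view₁₃CoPB8B10YZW = (θ.pinB8 λ).view₁₃CoPB10YZW`). [cite: Balaban1985UV3, Thm 1 p.257 + Thm 2 p.272; Balaban1985RegularSpaces, Thm 8 p.101 (bookkeeping)] -/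
theorem b10_main_of_upS_view₁₃CoPB8B10YZW (lam : ResidB8 θ.toStage3Params) (Mstar : ℕ) (ops : OpsY N θ.toStage3Params Mstar) (ζ : ResidZ F N)
    (lamW : ResidW F N) (hup : ∀ P, w.up P = upOfRecord₅CS F N (θ.view₁₃CoPB8B10YZW F N lam Mstar ops ζ lamW) P) (hUV : PrintedUV3V N θ.L)
    (P : B12.RunParams) : Dag.B10_main (leavesP w P) :=
  b10_main_of_up_eq (hup P) (upOfRecord₅CS_view₁₃CoPB8B10YZW_leaves F N θ lam Mstar ops ζ lamW P).2.2.2.1 hUV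

end Pointed

/-! ## §2 THE ∃-CURRENCY AT THE CORE KEY — N08's conjunct of a Core-keyed nodes-∃, the guard `ZtUnity ∧ SlotsNondegenerate₁₃` riding on `θ` -/

section Currency

/-- **AT THE CO DATUM OF ANY ADMISSIBLE STAGE-13 TUPLE WITH THE CORE PROVISOS, a world (any window height `γw`, block size `θ.L`) that IS a ₁₃CCoP record of
`datumOfRecord₁₃CoP F N θ h`, bound over the [B10]-PINNED CoP view, carrying N08 at every run — from the one slot instance `PrintedUV3V N θ.L`** (§0b
`exists_world_isRecordOfRecord₁₃CCoP_pinB10` + §1).  The other nodes' pointed closers apply AT THIS `w` (its presenting parameter is `θ.pinB10`: every residual layer but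
the B10 run family, every history, law and letter is `θ`'s — `Record13Carriers` §2). [cite: Balaban1985UV3, Thm 1 p.257, Thm 2 p.272; Balaban1989LargeFieldII, Thm 1 + (0.1) pp.355–356 (the record's world; bookkeeping)] -/
theorem exists_world₁₃CCoP_b10_main_of_slot (θ : Stage13Params F N) (h : θ.Provisos₁₃Core F N) (hθ : θ.Admissible F N) {γw : ℝ} (hγw : 0 < γw ∧ γw ≤ θ.γ)
    (hUV : PrintedUV3V N θ.L) :
    ∃ w : WorldP, IsRecordOfRecord₁₃CCoP F N (datumOfRecord₁₃CoP F N θ h) w ∧ w.γ = γw ∧ w.L = (θ.L : ℝ) ∧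
      (∀ P, w.up P = upOfRecord₅C F N ((θ.pinB10 F N).toStage5₁₃CoP F N) P) ∧ ∀ P : B12.RunParams, Dag.B10_main (leavesP w P) := by
  obtain ⟨w, hR, hγ, hL, hup⟩ := exists_world_isRecordOfRecord₁₃CCoP_pinB10 θ h hθ hγw
  exact ⟨w, hR, hγ, hL, hup, b10_main_of_up_pinB10 θ hup hUV⟩

/-- **The four-pin twin** (package EXPOSED, as at Stage 12): at the same datum a world bound over `θ.view₁₃CoPB10YZW Mstar ops ζ lamW` that IS a ₁₃CCoP record and carries N08
at every run, from `PrintedUV3V N θ.L` — the world at which the other nodes' pointed closers over the four-pin view apply. [cite: Balaban1985UV3, Thm 1 p.257, Thm 2 p.272; Balaban1989LargeFieldII, Thm 1 + (0.1) pp.355–356 (bookkeeping)] -/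
theorem exists_world₁₃CCoP_view₁₃CoPB10YZW_b10_main_of_slot (θ : Stage13Params F N) (h : θ.Provisos₁₃Core F N) (hθ : θ.Admissible F N) (Mstar : ℕ)
    (ops : OpsY N θ.toStage3Params Mstar) (ζ : ResidZ F N) (lamW : ResidW F N) {γw : ℝ} (hγw : 0 < γw ∧ γw ≤ θ.γ) (hUV : PrintedUV3V N θ.L) :
    ∃ w : WorldP, IsRecordOfRecord₁₃CCoP F N (datumOfRecord₁₃CoP F N θ h) w ∧ w.γ = γw ∧ w.L = (θ.L : ℝ) ∧
      (∀ P, w.up P = upOfRecord₅C F N (θ.view₁₃CoPB10YZW F N Mstar ops ζ lamW) P) ∧ ∀ P : B12.RunParams, Dag.B10_main (leavesP w P) := by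
  obtain ⟨w, hR, hγ, hL, hup⟩ := exists_world_isRecordOfRecord₁₃CCoP_view₁₃CoPB10YZW θ h hθ Mstar ops ζ lamW hγw
  exact ⟨w, hR, hγ, hL, hup, b10_main_of_up_view₁₃CoPB10YZW θ Mstar ops ζ lamW hup hUV⟩

/-- **THE PINNED PRESENTATION**: from `θ`, its provisos, admissibility and guard, and `PrintedUV3V N θ.L` — a presenting parameter `θ' := θ.pinB10` with provisos `h'`, THE SAME
datum (`datumOfRecord₁₃CoP_pinB10`), the guard and admissibility read AT `θ'` (carrier-blind, `Record13Carriers` §2), and a world bound over `θ'.toStage5₁₃CoP` (def-T's UNPINNED clause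
shape at `θ'` — the `hup` a pointed Stage-13 assembler takes) that IS a ₁₃CCoP record and carries N08 at every run. [cite: Balaban1985UV3, Thm 1 p.257, Thm 2 p.272; Balaban1989LargeFieldII, Thm 1 + (0.1) pp.355–356; Balaban1988Convergent, (3.16)–(3.22) pp.268–269 (the guard; bookkeeping)] -/
theorem exists_pinned_presentation₁₃CCoP_b10_main (θ : Stage13Params F N) (h : θ.Provisos₁₃Core F N) (hθ : θ.Admissible F N)
    (hG : θ.ZtUnity F N ∧ θ.SlotsNondegenerate₁₃ F N) {γw : ℝ} (hγw : 0 < γw ∧ γw ≤ θ.γ) (hUV : PrintedUV3V N θ.L) :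
    ∃ (θ' : Stage13Params F N) (h' : θ'.Provisos₁₃Core F N) (w : WorldP), (θ'.ZtUnity F N ∧ θ'.SlotsNondegenerate₁₃ F N) ∧ θ'.Admissible F N ∧
      datumOfRecord₁₃CoP F N θ' h' = datumOfRecord₁₃CoP F N θ h ∧ w.C = (datumOfRecord₁₃CoP F N θ' h').C ∧ (0 < w.γ ∧ w.γ ≤ θ'.γ) ∧ w.γ = γw ∧ w.L = (θ'.L : ℝ) ∧
      (∀ P, w.up P = upOfRecord₅C F N (θ'.toStage5₁₃CoP F N) P) ∧ IsRecordOfRecord₁₃CCoP F N (datumOfRecord₁₃CoP F N θ h) w ∧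
      ∀ P : B12.RunParams, Dag.B10_main (leavesP w P) := by
  obtain ⟨w, hR, hγ, hL, hup, hN⟩ := exists_world₁₃CCoP_b10_main_of_slot θ h hθ hγw hUV
  refine ⟨θ.pinB10 F N, h.pinB10, w, (N08AtRecord13.guard_pinB10_iff θ).2 hG, (Stage13Params.pinB10_admissible_iff F N θ).2 hθ,
    datumOfRecord₁₃CoP_pinB10 F N θ h, ?_, ?_, hγ, hL, fun P => (hup P).trans (by rw [Stage13Params.toStage5₁₃CoP_pinB10]), hR, hN⟩
  · rw [datumOfRecord₁₃CoP_pinB10 F N θ h]; exact construction_eq_of_isRecordOfRecord₁₃CCoP hR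
  · rw [hγ]; exact hγw

/-- **THE FOUR-PIN PRESENTATION** (package EXPOSED): presenting parameter `θ' := (((θ.pinB10).pinY (Y9OfRecord …)).pinZ (Z11OfRecord ζ)).pinW (WOfRecord₁₃ θ lamW)` — THE SAME datum
(the four `datumOfRecord₁₃CoP_pin<G>`), guard and admissibility read AT `θ'` (pin-blind, §0b), a world bound over `θ'.toStage5₁₃CoP` (= `θ.view₁₃CoPB10YZW …`, `view₁₃CoPB10YZW_eq`) that IS a
₁₃CCoP record of `datumOfRecord₁₃CoP θ h` and carries N08 at every run — from `PrintedUV3V N θ.L`.  The shape a pointed Stage-13 assembler consumes when it presents the record at the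
quadruply pinned parameter. [cite: Balaban1985UV3, Thm 1 p.257, Thm 2 p.272; Balaban1989LargeFieldII, Thm 1 + (0.1) pp.355–356; Balaban1988Convergent, (3.16)–(3.22) pp.268–269 (bookkeeping)] -/
theorem exists_pinned4_presentation₁₃CCoP_b10_main (θ : Stage13Params F N) (h : θ.Provisos₁₃Core F N) (hθ : θ.Admissible F N)
    (hG : θ.ZtUnity F N ∧ θ.SlotsNondegenerate₁₃ F N) (Mstar : ℕ) (ops : OpsY N θ.toStage3Params Mstar) (ζ : ResidZ F N) (lamW : ResidW F N) {γw : ℝ}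
    (hγw : 0 < γw ∧ γw ≤ θ.γ) (hUV : PrintedUV3V N θ.L) :
    ∃ (θ' : Stage13Params F N) (h' : θ'.Provisos₁₃Core F N) (w : WorldP), (θ'.ZtUnity F N ∧ θ'.SlotsNondegenerate₁₃ F N) ∧ θ'.Admissible F N ∧
      datumOfRecord₁₃CoP F N θ' h' = datumOfRecord₁₃CoP F N θ h ∧ w.C = (datumOfRecord₁₃CoP F N θ' h').C ∧ (0 < w.γ ∧ w.γ ≤ θ'.γ) ∧ w.γ = γw ∧ w.L = (θ'.L : ℝ) ∧
      (∀ P, w.up P = upOfRecord₅C F N (θ'.toStage5₁₃CoP F N) P) ∧ (∀ P, w.up P = upOfRecord₅C F N (θ.view₁₃CoPB10YZW F N Mstar ops ζ lamW) P) ∧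
      IsRecordOfRecord₁₃CCoP F N (datumOfRecord₁₃CoP F N θ h) w ∧ ∀ P : B12.RunParams, Dag.B10_main (leavesP w P) := by
  obtain ⟨w, hR, hγ, hL, hup, hN⟩ := exists_world₁₃CCoP_view₁₃CoPB10YZW_b10_main_of_slot θ h hθ Mstar ops ζ lamW hγw hUV
  have h₁ : (θ.pinB10 F N).Provisos₁₃Core F N := h.pinB10
  have h₂ : ((θ.pinB10 F N).pinY F N (Y9OfRecord N θ.toStage3Params Mstar ops)).Provisos₁₃Core F N := h₁.pinY _
  have h₃ : (((θ.pinB10 F N).pinY F N (Y9OfRecord N θ.toStage3Params Mstar ops)).pinZ F N (Z11OfRecord F N ζ)).Provisos₁₃Core F N := h₂.pinZ _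
  have h₄ : ((((θ.pinB10 F N).pinY F N (Y9OfRecord N θ.toStage3Params Mstar ops)).pinZ F N (Z11OfRecord F N ζ)).pinW F N (WOfRecord₁₃ F N θ lamW)).Provisos₁₃Core F N :=
    h₃.pinW _
  have hD : datumOfRecord₁₃CoP F N _ h₄ = datumOfRecord₁₃CoP F N θ h := by
    rw [datumOfRecord₁₃CoP_pinW F N _ h₃, datumOfRecord₁₃CoP_pinZ F N _ h₂, datumOfRecord₁₃CoP_pinY F N _ h₁, datumOfRecord₁₃CoP_pinB10 F N θ h]
  refine ⟨_, h₄, w,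
    (N08AtRecord13.guard_pinW_iff _ _).2 ((N08AtRecord13.guard_pinZ_iff _ _).2 ((N08AtRecord13.guard_pinY_iff _ _).2 ((N08AtRecord13.guard_pinB10_iff θ).2 hG))),
    (Stage13Params.pinW_admissible_iff F N _ _).2 ((Stage13Params.pinZ_admissible_iff F N _ _).2
      ((Stage13Params.pinY_admissible_iff F N _ _).2 ((Stage13Params.pinB10_admissible_iff F N _).2 hθ))),
    hD, ?_, ?_, hγ, hL, fun P => (hup P).trans (by rw [Stage13Params.view₁₃CoPB10YZW_eq]), hup, hR, hN⟩
  · rw [hD]; exact construction_eq_of_isRecordOfRecord₁₃CCoP hR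
  · rw [hγ]; exact hγw

/-- **«A CORE-KEYED INHABITATION ⟹ N08's CONJUNCT OF A CORE-KEYED STAGE-13 NODES-∃»**, generic `N`: from `∃ θ, Provisos₁₃Core ∧ (ZtUnity ∧ SlotsNondegenerate₁₃) ∧ Admissible` at `F`
(HYPOTHESIS `hI`, the guard bundled as ONE conjunct and carried to the SAME `θ` untouched) and the slot of record at every odd `L > 1` (HYPOTHESIS `hUV`, the node's object gap),
SOME guarded admissible tuple `θ`, provisos `h` and world `w` with `IsRecordOfRecord₁₃CCoP F N (datumOfRecord₁₃CoP F N θ h) w` and `Dag.B10_main` at every run (`γw := θ.γ`).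
NOT the stub (twelve conjuncts missing), NOT a discharge. [cite: Balaban1985UV3, Thm 1 p.257, Thm 2 p.272; Balaban1989LargeFieldII, Thm 1 + (0.1) pp.355–356; Balaban1988Convergent, (3.16)–(3.22) pp.268–269 (bookkeeping)] -/
theorem exists_guarded_record₁₃CCoP_b10_main_of_inhabited13Core
    (hI : ∃ θ : Stage13Params F N, θ.Provisos₁₃Core F N ∧ (θ.ZtUnity F N ∧ θ.SlotsNondegenerate₁₃ F N) ∧ θ.Admissible F N)
    (hUV : ∀ L : ℕ, Odd L → 1 < L → PrintedUV3V N L) :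
    ∃ (θ : Stage13Params F N) (h : θ.Provisos₁₃Core F N) (w : WorldP), (θ.ZtUnity F N ∧ θ.SlotsNondegenerate₁₃ F N) ∧ θ.Admissible F N ∧
      IsRecordOfRecord₁₃CCoP F N (datumOfRecord₁₃CoP F N θ h) w ∧ ∀ P : B12.RunParams, Dag.B10_main (leavesP w P) := by
  obtain ⟨θ, h, hG, hθ⟩ := hI
  obtain ⟨w, hR, -, -, -, hN⟩ := exists_world₁₃CCoP_b10_main_of_slot θ h hθ ⟨hθ.toStage9.gamma_pos, le_rfl⟩ (hUV θ.L θ.hL.1 θ.hL.2)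
  exact ⟨θ, h, w, hG, hθ, hR, hN⟩

/-- **THE SAME AT THE GROUP OF RECORD `N = 2`**, hypothesis = the Core-keyed inhabitation text (the rev-16 K0‴ body at `F` under `Provisos₁₃ ↦ Provisos₁₃Core`:
`∃ θ : Stage13Params F 2, θ.Provisos₁₃Core F 2 ∧ (θ.ZtUnity F 2 ∧ θ.SlotsNondegenerate₁₃ F 2) ∧ θ.Admissible F 2`): N08's conjunct of the ₁₃ nodes-∃ from it and the slot at every
odd `L > 1`.  NOT the stub, NOT a discharge. [cite: Balaban1985UV3, Thm 1 p.257, Thm 2 p.272; Balaban1989LargeFieldII, Thm 1 + (0.1) pp.355–356 (bookkeeping)] -/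
theorem exists_guarded_record₁₃CCoP_b10_main_of_inhabited13Core_two (F : T4Family)
    (hI : ∃ θ : Stage13Params F 2, θ.Provisos₁₃Core F 2 ∧ (θ.ZtUnity F 2 ∧ θ.SlotsNondegenerate₁₃ F 2) ∧ θ.Admissible F 2)
    (hUV : ∀ L : ℕ, Odd L → 1 < L → PrintedUV3V 2 L) :
    ∃ (θ : Stage13Params F 2) (h : θ.Provisos₁₃Core F 2) (w : WorldP), (θ.ZtUnity F 2 ∧ θ.SlotsNondegenerate₁₃ F 2) ∧ θ.Admissible F 2 ∧
      IsRecordOfRecord₁₃CCoP F 2 (datumOfRecord₁₃CoP F 2 θ h) w ∧ ∀ P : B12.RunParams, Dag.B10_main (leavesP w P) :=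
  exists_guarded_record₁₃CCoP_b10_main_of_inhabited13Core hI hUV

end Currency

/-! ## §3 ON THE STAGE-13 WITNESS LINE OF RECORD `θ₁₃ = theta13LiveOfRecord F N` (θ-level maker, background-free; block size `F.L`, window `γ = 1∕2`; `_L ∕ _γ` are p491313's
`rfl` faces, cited) — N08's share costs `PrintedUV3V N F.L` -/

section WitnessLine
variable (F N)

/-- **N08's SHARE OF THE STAGE-13 NODES STUB ON THE WITNESS LINE OF RECORD COSTS THE SINGLE PROP `PrintedUV3V N F.L`** (plus the Core provisos `hP` at `θ₁₃`, HYPOTHESIS;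
admissibility is K0a's THEOREM `admissible_theta13LiveOfRecord`): a world of `datumOfRecord₁₃CoP F N θ₁₃ hP` (`w.γ = 1∕2`, `w.L = F.L`), bound over the [B10]-pinned view of `θ₁₃`,
that is a ₁₃CCoP record and carries N08 at every run.  At `N = 2`: [Balaban1985UV3] Thm 1-compact ∧ Thm 2 with their printed ∃-prefix for SU(2) at the family's block size `F.L`,
at some version of print's transformations. [cite: Balaban1985UV3, Thm 1 p.257, Thm 2 p.272; Balaban1989LargeFieldII, Thm 1 + (0.1) pp.355–356; Balaban1987RG1, (0.21) p.256 (bookkeeping)] -/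
theorem exists_world₁₃CCoP_b10_main_at_theta13LiveOfRecord (hP : (theta13LiveOfRecord F N).Provisos₁₃Core F N) (hUV : PrintedUV3V N F.L) :
    ∃ w : WorldP, IsRecordOfRecord₁₃CCoP F N (datumOfRecord₁₃CoP F N (theta13LiveOfRecord F N) hP) w ∧ w.γ = 1 / 2 ∧ w.L = (F.L : ℝ) ∧
      (∀ P, w.up P = upOfRecord₅C F N (((theta13LiveOfRecord F N).pinB10 F N).toStage5₁₃CoP F N) P) ∧
      ∀ P : B12.RunParams, Dag.B10_main (leavesP w P) :=
  exists_world₁₃CCoP_b10_main_of_slot (theta13LiveOfRecord F N) hP (admissible_theta13LiveOfRecord F N) (γw := 1 / 2)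
    ⟨one_half_pos, (N08AtRecord13.theta13LiveOfRecord_γ F N).symm.le⟩ hUV

/-- **EXACT COST ON THE LINE**: at any world bound over the [B10]-pinned view of `θ₁₃`, N08 at a run ⟺ «in-edge leaves ⟹ `PrintedUV3V N F.L`». [cite: Balaban1985UV3, Thm 1 p.257, Thm 2 p.272] -/
theorem b10_main_iff_at_theta13LiveOfRecord {w : WorldP}
    (hup : ∀ P, w.up P = upOfRecord₅C F N (((theta13LiveOfRecord F N).pinB10 F N).toStage5₁₃CoP F N) P) (P : B12.RunParams) :
    Dag.B10_main (leavesP w P) ↔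
      ((leavesP w P).b5 → (leavesP w P).b6 → (leavesP w P).b7 → (leavesP w P).b8 → (leavesP w P).b9 → (leavesP w P).b11 → PrintedUV3V N F.L) :=
  b10_main_iff_of_up_pinB10 (theta13LiveOfRecord F N) hup P

/-- **N08's CONJUNCT OF THE STAGE-13 NODES-∃, WITNESSED AT `θ₁₃` OF RECORD, `N = 2`** — from the Core provisos at the witness (`hP : θ₁₃.Provisos₁₃Core F 2`, HYPOTHESIS) and
`PrintedUV3V 2 F.L`: the guard (K0a's HYPOTHESIS-FREE `ztUnity_theta13LiveOfRecord` ∕ `slotsNondegenerate₁₃_theta13LiveOfRecord_of_hasResiduals`) and admissibility are K0a's theorems BY NAME.  NOT the stub, NOT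
a discharge. [cite: Balaban1985UV3, Thm 1 p.257, Thm 2 p.272; Balaban1988Convergent, Thm 1 p.262, (3.16)–(3.22) pp.268–269; Balaban1989LargeFieldI, (0.3)–(0.4) p.176 (bookkeeping)] -/
theorem exists_guarded_record₁₃CCoP_b10_main_of_theta13Live_provisosCore_two (F : T4Family) (hP : (theta13LiveOfRecord F 2).Provisos₁₃Core F 2)
    (hUV : PrintedUV3V 2 F.L) :
    ∃ (θ : Stage13Params F 2) (h : θ.Provisos₁₃Core F 2) (w : WorldP), (θ.ZtUnity F 2 ∧ θ.SlotsNondegenerate₁₃ F 2) ∧ θ.Admissible F 2 ∧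
      IsRecordOfRecord₁₃CCoP F 2 (datumOfRecord₁₃CoP F 2 θ h) w ∧ ∀ P : B12.RunParams, Dag.B10_main (leavesP w P) := by
  obtain ⟨w, hR, -, -, -, hN⟩ := exists_world₁₃CCoP_b10_main_at_theta13LiveOfRecord F 2 hP hUV
  exact ⟨_, hP, w, ⟨ztUnity_theta13LiveOfRecord F 2, slotsNondegenerate₁₃_theta13LiveOfRecord_of_hasResiduals F 2⟩, admissible_theta13LiveOfRecord F 2, hR, hN⟩

end WitnessLine

end Summit.QuantumFields.YangMills.BalabanUVNodes.N08AtRecord13CoP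

end
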